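import Literature.Algebra.Homology.LaurentCechAway
import Literature.Algebra.Homology.SerreFiniteness
import Literature.AlgebraicGeometry.Morphisms.CechH1
import Literature.AlgebraicGeometry.Motives.IntegralProjectiveSpace
import Mathlib.AlgebraicGeometry.ProjectiveSpectrum.Basic
import Mathlib.AlgebraicGeometry.Morphisms.ClosedImmersion
import HarnessLib

/-!
# Closed subschemes of `𝐏^r_A`: evaluation of degree-zero fractions, the homogeneous ideal, and the Čech complex of `𝒪_Z`

For a commutative ring `A`, `𝐏 = 𝐏^r_A = Proj A[x₀, …, x_r]` (`ProjCech.PP`) and a morphism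
`ι : Z → 𝐏` (a closed immersion where stated), with `Z_s = ι⁻¹ D₊(X_s)` (`ProjCech.Zop`) and
`B_s = (P_{(X_s)})₀ ⊆ L` (`LaurentCech.Bsub`, `Literature/Algebra/Homology/LaurentCechAway`):

* `ProjCech.evalRing ι s : B_s →+* Γ(Z, Z_s)`, `ProjCech.evalAlg` — **evaluation of degree-zero fractions
  on `Z`** (`B_s ≅ (P_{(X_s)})₀ → Γ(𝐏, D₊(X_s)) → Γ(Z, Z_s)`, Mathlib `Proj.awayToSection`); it is
  `A`-linear (`evalRing_algebraMap`, via the tree's `ProjBaseChangeRing.awayι_projToSpec` and the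
  injectivity of restriction to the chart), compatible with restriction (`evalRing_res`, Mathlib
  `Proj.awayMap_awayToSection`) and surjective for a closed immersion (`evalRing_surjective`, Mathlib
  `Scheme.Hom.app_surjective`);
* `ProjCech.idealZ ι ⊆ P` — **the homogeneous ideal of `Z`**: `k ∈ 𝔞` iff every fraction `k_b / x_j^b`
  vanishes on `Z_j` (the largest homogeneous ideal defining `Z`, i.e. `Γ_*(𝓘_Z)`; Hartshorne II Prop. 5.9,
  Cor. 5.16 (a)); it is an ideal (`fracB_mul`) and homogeneous (`hcomp_mem_idealZ`); `ProjCech.KZ` is the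
  corresponding graded submodule of `P^{pt}`;
* **`(𝔞_{X_s})₀ = ker (B_s → Γ(Z, Z_s))`** for `s ≠ ∅`: `evalRing_eq_zero_of_mem_idealZ` (⊆) and
  `exists_mem_idealZ_of_evalRing_eq_zero` (⊇, for `ι` affine). The second uses the geometric input
  `Zop_insert_eq_basicOpen` — **`Z_{s+j}` is the basic open of `t_{s,j}|_Z` in `Z_j`** (Mathlib
  `Proj.awayι_preimage_basicOpen` read back in `𝐏`, `Dplus_insert_eq_basicOpen`) — so that sections of the
  affine `Z_j` vanishing on `Z_{s+j}` are killed by a power of `t|_Z` (Mathlib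
  `IsAffineOpen.isLocalization_basicOpen`, `exists_pow_mul_eq_zero`), plus clearing denominators in `L`;
* `ProjCech.cechZ ι` — **the (alternating) Čech complex `Č(𝒰, 𝒪_Z)` on the cover `Z_i = Z ∩ D₊(x_i)`**
  (Stacks Project, Tag 01FG) as a cochain complex of `A`-modules (`QX`, `dQ`; `d ∘ d = 0` transported
  from `Č_0(P)` along the surjection `qMap`), the comparison morphism `qHom : Č_0(P) → Č(𝒰, 𝒪_Z)` and
  **the short exact sequence `0 → Č_0(𝔞) → Č_0(P) → Č(𝒰, 𝒪_Z) → 0`** (`sesZ`, `shortExact_sesZ`: the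
  algebraic form of `0 → 𝓘_Z → 𝒪_𝐏 → ι_*𝒪_Z → 0` on the affine opens `D₊(X_σ)`; Hartshorne III.5, proof of
  Thm. 5.2);
* `ProjCech.moduleFinite_homology_cechZ` — **`H^i(Č(𝒰, 𝒪_Z))` is a finitely generated `A`-module for
  `i ≥ 1`, `A` Noetherian** (Serre, Hartshorne III Thm. 5.2 (a) for `𝒪_Z`), by
  `LaurentCech.moduleFinite_homology_of_shortExact` (`Literature/Algebra/Homology/SerreFiniteness`).

The identification with the tree's `CechH1` (all ordered pairs) and the finiteness of `Ȟ¹(𝒰, 𝒪_Z)` are in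
`Literature/AlgebraicGeometry/Morphisms/CechH1ProjectiveFinite`. Everything is proved; no named facts.
Mathlib searched (pin v4.32): `Proj.awayToSection`, `Proj.basicOpenIsoSpec(_inv_ι)`,
`Proj.basicOpenToSpec_app_top`, `Proj.awayι_preimage_basicOpen`, `Proj.awayMap_awayToSection`,
`Scheme.Hom.app_surjective`, `IsAffineOpen.isLocalization_basicOpen`, `basicOpen_eq_of_affine`,
`Scheme.preimage_basicOpen` (used); Mathlib has no ideal-of-a-closed-subscheme-of-Proj / `Γ_*`, no Čech
cohomology of schemes.

## References

* R. Hartshorne, *Algebraic Geometry*, GTM 52, Springer (1977): II Prop. 2.5, II Prop. 5.9, II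
  Cor. 5.16; III Thm. 4.5, III Thm. 5.2 (a) and its proof (p. 228). [Hartshorne1977]
* The Stacks Project, Tags 01FG (alternating Čech complex), 01XT. [StacksProject]
-/

noncomputable section

open CategoryTheory AlgebraicGeometry TopologicalSpace Opposite
open Literature.Algebra.Homology Literature.Algebra.Homology.LaurentCech

universe u

attribute [local instance] MvPolynomial.gradedAlgebra
  Literature.AlgebraicGeometry.Motives.ProjBaseChange.algebraBase

namespace Literature.AlgebraicGeometry.Morphisms

namespace ProjCech

variable (A : Type u) [CommRing A] (r : ℕ)

/-- The standard grading of `P = A[x₀, …, x_r]` by degree. [folklore] -/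
abbrev grading : ℕ → Submodule A (MvPolynomial (Fin (r + 1)) A) :=
  MvPolynomial.homogeneousSubmodule (Fin (r + 1)) A

/-- Projective `r`-space `𝐏^r_A = Proj A[x₀, …, x_r]`. [folklore] -/
abbrev PP : Scheme.{u} := Proj (grading A r)

/-- The structure morphism `𝐏^r_A → Spec A` (the tree's `ProjBaseChangeRing.projToSpec`). [folklore] -/
abbrev toSpec : PP A r ⟶ Spec (.of A) := Motives.ProjBaseChangeRing.projToSpec (Fin (r + 1)) A

/-- The basic open `D₊(X_s) ⊆ 𝐏^r_A` of the monomial `X_s = Π_{i ∈ s} x_i`. [folklore] -/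
abbrev Dplus (s : Finset (Fin (r + 1))) : (PP A r).Opens := Proj.basicOpen (grading A r) (Xs A s)

variable {A r}

/-- `D₊(X_t) ⊆ D₊(X_s)` for `s ⊆ t`. [folklore] -/
theorem Dplus_mono {s t : Finset (Fin (r + 1))} (h : s ⊆ t) : Dplus A r t ≤ Dplus A r s :=
  Proj.basicOpen_mono _ _ _ ⟨Xs A (t \ s), by
    rw [← Xs_union (Finset.disjoint_sdiff), Finset.union_sdiff_of_subset h]⟩

/-- The chart `Spec (P_{(X_s)})₀ → 𝐏^r_A`, an open immersion onto `D₊(X_s)` (`s` non-empty).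
[folklore] -/
def chart (s : Finset (Fin (r + 1))) (hs : s.Nonempty) :
    Spec (.of (HomogeneousLocalization.Away (grading A r) (Xs A s))) ⟶ PP A r :=
  Proj.awayι (grading A r) (Xs A s) (Xs_mem s) (Finset.card_pos.mpr hs)

/-- The chart is an open immersion. [folklore] -/
instance isOpenImmersion_chart (s : Finset (Fin (r + 1))) (hs : s.Nonempty) :
    IsOpenImmersion (chart (A := A) s hs) := by
  unfold chart; infer_instance

/-- The chart of `s` has image `D₊(X_s)`. [folklore] -/
theorem opensRange_chart (s : Finset (Fin (r + 1))) (hs : s.Nonempty) :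
    (chart (A := A) s hs).opensRange = Dplus A r s :=
  Proj.opensRange_awayι (grading A r) (Xs A s) (Xs_mem s) (Finset.card_pos.mpr hs)

/-- The chart of `s` lands in `D₊(X_s)`: its preimage is everything. [folklore] -/
theorem chart_preimage_Dplus (s : Finset (Fin (r + 1))) (hs : s.Nonempty) :
    chart s hs ⁻¹ᵁ Dplus A r s = ⊤ := by
  rw [← opensRange_chart s hs]
  exact Scheme.Hom.preimage_opensRange _

/-- For an isomorphism of schemes `e`, pulling back global functions along `e.inv` is injective.
[folklore] -/
theorem appTop_inv_injective {X Y : Scheme.{u}} (e : X ≅ Y) : Function.Injective e.inv.appTop := by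
  intro a b h
  have key : ∀ x, e.hom.appTop (e.inv.appTop x) = x := fun x => by
    rw [← CategoryTheory.ConcreteCategory.comp_apply, ← Scheme.Hom.comp_appTop, Iso.hom_inv_id,
      Scheme.Hom.id_appTop]
    rfl
  rw [← key a, ← key b, h]

/-- The identification `D₊(X_s) ≅ Spec (P_{(X_s)})₀` of the basic open subscheme (Mathlib
`Proj.basicOpenIsoSpec`). [folklore] -/
abbrev isoD (s : Finset (Fin (r + 1))) (hs : s.Nonempty) :
    (Dplus A r s).toScheme ≅ Spec (CommRingCat.of (HomogeneousLocalization.Away (grading A r) (Xs A s))) :=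
  Proj.basicOpenIsoSpec (grading A r) (Xs A s) (Xs_mem s) (Finset.card_pos.mpr hs)

/-- Restriction from `Γ(𝐏, D₊(X_s))` to the chart `Γ(Spec (P_{(X_s)})₀, ⊤)`:
`Γ(𝐏, D₊(X_s)) ≅ Γ(D₊(X_s), ⊤) ≅ Γ(Spec (P_{(X_s)})₀, ⊤)`. [folklore] -/
def resChart (s : Finset (Fin (r + 1))) (hs : s.Nonempty) :
    Γ(PP A r, Dplus A r s) ⟶ Γ(Spec (CommRingCat.of (HomogeneousLocalization.Away (grading A r) (Xs A s))), ⊤) :=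
  (Dplus A r s).topIso.inv ≫ (isoD s hs).inv.appTop

/-- Restriction to the chart is injective (it is an isomorphism). [folklore] -/
theorem resChart_injective (s : Finset (Fin (r + 1))) (hs : s.Nonempty) :
    Function.Injective (resChart (A := A) s hs) := by
  rw [resChart]
  exact (appTop_inv_injective (isoD s hs)).comp (ConcreteCategory.bijective_of_isIso (Dplus A r s).topIso.inv).1

/-- Restricting a global function to the chart is pulling it back along the chart (as morphisms).
[folklore] -/
theorem map_resChart (s : Finset (Fin (r + 1))) (hs : s.Nonempty) :
    (PP A r).presheaf.map (homOfLE (le_top : Dplus A r s ≤ ⊤)).op ≫ resChart s hs = (chart s hs).appTop := by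
  rw [resChart, chart, ← Proj.basicOpenIsoSpec_inv_ι, Scheme.Hom.comp_appTop, Scheme.Opens.ι_appTop,
    Scheme.Opens.topIso_inv, ← Category.assoc]
  congr 1

/-- Restricting a global function to the chart is pulling it back along the chart. [folklore] -/
theorem resChart_map_appTop (s : Finset (Fin (r + 1))) (hs : s.Nonempty) (y : Γ(PP A r, ⊤)) :
    resChart s hs ((PP A r).presheaf.map (homOfLE (le_top : Dplus A r s ≤ ⊤)).op y) =
      (chart s hs).appTop y := by
  rw [← CategoryTheory.ConcreteCategory.comp_apply, map_resChart]

/-- **Pulling back `awayToSection b` to the chart gives `b`** (through `Γ(Spec B, ⊤) ≅ B`).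
[folklore] -/
theorem resChart_awayToSection (s : Finset (Fin (r + 1))) (hs : s.Nonempty)
    (b : HomogeneousLocalization.Away (grading A r) (Xs A s)) :
    resChart s hs (Proj.awayToSection (grading A r) (Xs A s) b) =
      (Scheme.ΓSpecIso (.of (HomogeneousLocalization.Away (grading A r) (Xs A s)))).inv b := by
  rw [resChart, CategoryTheory.ConcreteCategory.comp_apply]
  have h3 : (Dplus A r s).topIso.inv (Proj.awayToSection (grading A r) (Xs A s) b) =
      (isoD s hs).hom.appTop ((Scheme.ΓSpecIso (.of _)).inv b) := by
    rw [isoD, Proj.basicOpenIsoSpec_hom, Scheme.Hom.appTop, Proj.basicOpenToSpec_app_top]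
    simp only [CategoryTheory.ConcreteCategory.comp_apply]
    rw [CategoryTheory.Iso.inv_hom_id_apply]
  rw [h3, ← CategoryTheory.ConcreteCategory.comp_apply, ← Scheme.Hom.comp_appTop, Iso.inv_hom_id,
    Scheme.Hom.id_appTop]
  rfl

/-- **The `A`-structure of `Γ(𝐏, D₊(X_s))` on the chart**: the global function `a ∈ A` restricted to
`D₊(X_s)` is `awayToSection` of `a / 1 ∈ (P_{(X_s)})₀`. [folklore] -/
theorem map_appTop_toSpec_eq_awayToSection (s : Finset (Fin (r + 1))) (hs : s.Nonempty) (a : A) :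
    (PP A r).presheaf.map (homOfLE (le_top : Dplus A r s ≤ ⊤)).op
        ((toSpec A r).appTop ((Scheme.ΓSpecIso (.of A)).inv a)) =
      Proj.awayToSection (grading A r) (Xs A s)
        (algebraMap A (HomogeneousLocalization.Away (grading A r) (Xs A s)) a) := by
  apply resChart_injective s hs
  rw [resChart_awayToSection, resChart_map_appTop, ← CategoryTheory.ConcreteCategory.comp_apply,
    ← Scheme.Hom.comp_appTop]
  have h2 : chart (A := A) s hs ≫ toSpec A r =
      Spec.map (CommRingCat.ofHom (algebraMap A (HomogeneousLocalization.Away (grading A r) (Xs A s)))) :=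
    Motives.ProjBaseChangeRing.awayι_projToSpec (Fin (r + 1)) (Xs_mem s) (Finset.card_pos.mpr hs)
  rw [h2, ← CategoryTheory.ConcreteCategory.comp_apply, ← Scheme.ΓSpecIso_inv_naturality]
  rfl

/-! ### The evaluation maps `B_s → Γ(Z, ι⁻¹ D₊(X_s))` of a closed subscheme `Z` -/

variable {Z : Scheme.{u}} (ι : Z ⟶ PP A r)

/-- The structure morphism `Z → 𝐏^r_A → Spec A`. [folklore] -/
abbrev strZ : Z ⟶ Spec (.of A) := ι ≫ toSpec A r

/-- The open `Z_s = ι⁻¹ D₊(X_s)` of `Z`. [folklore] -/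
abbrev Zop (s : Finset (Fin (r + 1))) : Z.Opens := ι ⁻¹ᵁ Dplus A r s

/-- `Z_t ⊆ Z_s` for `s ⊆ t`. [folklore] -/
theorem Zop_mono {s t : Finset (Fin (r + 1))} (h : s ⊆ t) : Zop ι t ≤ Zop ι s :=
  Scheme.Hom.preimage_mono _ (Dplus_mono h)

/-- **The evaluation ring homomorphism `B_s → Γ(Z, Z_s)`**: `B_s ≅ (P_{(X_s)})₀ → Γ(𝐏, D₊(X_s)) → Γ(Z, Z_s)`
(`awayEquiv`, Mathlib `Proj.awayToSection`, pull-back along `ι`). [folklore] -/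
def evalRing (s : Finset (Fin (r + 1))) : Bsub A r s →+* Sections (strZ ι) (Zop ι s) :=
  ((ι.app (Dplus A r s)).hom.comp (Proj.awayToSection (grading A r) (Xs A s)).hom).comp
    (awayEquiv A r s).symm.toRingHom

/-- `evalRing` unfolded. [folklore] -/
theorem evalRing_apply (s : Finset (Fin (r + 1))) (x : Bsub A r s) :
    evalRing ι s x = ι.app (Dplus A r s) (Proj.awayToSection (grading A r) (Xs A s)
      ((awayEquiv A r s).symm x)) := rfl

/-- `evalRing` on the image of a fraction `b ∈ (P_{(X_s)})₀`. [folklore] -/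
theorem evalRing_awayEquiv (s : Finset (Fin (r + 1))) (b : HomogeneousLocalization.Away (grading A r) (Xs A s)) :
    evalRing ι s (awayEquiv A r s b) = ι.app (Dplus A r s) (Proj.awayToSection (grading A r) (Xs A s) b) := by
  rw [evalRing_apply, RingEquiv.symm_apply_apply]

/-- **`evalRing` is `A`-linear**: it sends the constant `a` to the function `a`. [folklore] -/
theorem evalRing_algebraMap (s : Finset (Fin (r + 1))) (hs : s.Nonempty) (a : A) :
    evalRing ι s (algebraMap A (Bsub A r s) a) = algebraMap A (Sections (strZ ι) (Zop ι s)) a := by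
  -- `awayEquiv.symm (a) = a / 1`
  have h1 : (awayEquiv A r s).symm (algebraMap A (Bsub A r s) a) =
      algebraMap A (HomogeneousLocalization.Away (grading A r) (Xs A s)) a := by
    apply awayToL_injective s
    rw [awayToL_awayEquiv_symm]
    exact (awayToL_fromZeroRingHom s a).symm
  rw [evalRing_apply, h1, ← map_appTop_toSpec_eq_awayToSection s hs, Sections.algebraMap_apply,
    algebraMapΓ]
  change _ = Z.presheaf.map (homOfLE le_top).op ((ι ≫ toSpec A r).appTop ((Scheme.ΓSpecIso (.of A)).inv a))
  rw [Scheme.Hom.comp_appTop, CategoryTheory.ConcreteCategory.comp_apply,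
    ← CategoryTheory.ConcreteCategory.comp_apply, ← CategoryTheory.ConcreteCategory.comp_apply]
  have hnat := ι.naturality (homOfLE (le_top : Dplus A r s ≤ ⊤)).op
  exact congr_arg (fun φ => φ.hom ((toSpec A r).appTop ((Scheme.ΓSpecIso (.of A)).inv a))) hnat

/-- **The evaluation `A`-algebra homomorphism `B_s → Γ(Z, Z_s)`** (`s` non-empty). [folklore] -/
def evalAlg (s : Finset (Fin (r + 1))) (hs : s.Nonempty) : Bsub A r s →ₐ[A] Sections (strZ ι) (Zop ι s) :=
  { evalRing ι s with commutes' := evalRing_algebraMap ι s hs }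

/-- `evalAlg` is `evalRing`. [folklore] -/
@[simp] theorem evalAlg_apply (s : Finset (Fin (r + 1))) (hs : s.Nonempty) (x : Bsub A r s) :
    evalAlg ι s hs x = evalRing ι s x := rfl

/-- **Compatibility with restriction**: for `s ⊆ t` and `x ∈ B_s ⊆ B_t`,
`evalRing t x = (evalRing s x)|_{Z_t}`. [folklore] -/
theorem evalRing_res {s t : Finset (Fin (r + 1))} (hst : s ⊆ t) (x : Bsub A r s) :
    evalRing ι t ⟨x, Bsub_mono hst x.2⟩ = Sections.res (strZ ι) (Zop_mono ι hst) (evalRing ι s x) := by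
  -- write `x = awayToL s b`; then `x = awayToL t (awayMap b)`
  obtain ⟨b, hb⟩ : ∃ b, awayEquiv A r s b = x := (awayEquiv A r s).surjective x
  subst hb
  have hdisj : Disjoint s (t \ s) := Finset.disjoint_sdiff
  have ht : t = s ∪ t \ s := (Finset.union_sdiff_of_subset hst).symm
  have hx : Xs A t = Xs A s * Xs A (t \ s) := by rw [← Xs_union hdisj, ← ht]
  have h1 : (⟨(awayEquiv A r s b : L A r), Bsub_mono hst (awayEquiv A r s b).2⟩ : Bsub A r t) =
      awayEquiv A r t (HomogeneousLocalization.awayMap (grading A r) (Xs_mem (t \ s)) hx b) := by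
    apply Subtype.ext
    rw [coe_awayEquiv, coe_awayEquiv]
    exact (awayToL_awayMap (A := A) hdisj ht hx b).symm
  rw [h1, evalRing_awayEquiv, evalRing_awayEquiv, Sections.res_apply]
  have h2 := Proj.awayMap_awayToSection (grading A r) (Xs_mem (t \ s)) hx (f := Xs A s)
  have h3 := congr_arg (fun φ => (ι.app (Dplus A r t)) (φ.hom b)) h2
  simp only [CommRingCat.hom_comp, RingHom.coe_comp, Function.comp_apply, CommRingCat.hom_ofHom] at h3
  rw [h3, ← CategoryTheory.ConcreteCategory.comp_apply, ← CategoryTheory.ConcreteCategory.comp_apply,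
    Scheme.Hom.naturality]
  rfl

/-- `evalRing s` is surjective when `ι` is a closed immersion (`D₊(X_s)` is affine). [folklore] -/
theorem evalRing_surjective [IsClosedImmersion ι] (s : Finset (Fin (r + 1))) (hs : s.Nonempty) :
    Function.Surjective (evalRing ι s) := by
  intro y
  obtain ⟨t, ht⟩ := ι.app_surjective (Dplus A r s) (Proj.isAffineOpen_basicOpen _ _ (Xs_mem s)
    (Finset.card_pos.mpr hs)) y
  obtain ⟨b, hb⟩ := (ConcreteCategory.bijective_of_isIso
    (Proj.basicOpenIsoAway (grading A r) (Xs A s) (Xs_mem s) (Finset.card_pos.mpr hs)).hom).2 t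
  refine ⟨awayEquiv A r s b, ?_⟩
  rw [evalRing_awayEquiv, ← ht, ← hb]
  rfl

/-! ### The homogeneous ideal of `Z` -/

/-- **The homogeneous ideal `𝔞 ⊆ P` of the closed subscheme `Z`**: `k ∈ 𝔞` iff for every degree `b`
and every index `j` the fraction `k_b / x_j^b ∈ B_{{j}} = Γ(𝐏, D₊(x_j))` vanishes on `Z_j = Z ∩ D₊(x_j)`
(the largest homogeneous ideal defining `Z`, i.e. `Γ_*` of the ideal sheaf in all degrees;
Hartshorne II Prop. 5.9 / Cor. 5.16). [folklore] -/
def idealZ : Ideal (P A r) where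
  carrier := {k | ∀ (b : ℤ) (j : Fin (r + 1)), evalRing ι {j} (fracB A j b k) = 0}
  zero_mem' b j := by rw [fracB_zero, map_zero]
  add_mem' {k k'} hk hk' b j := by rw [fracB_add, map_add, hk, hk', add_zero]
  smul_mem' g k hk b j := by
    rw [smul_eq_mul, fracB_mul, map_sum]
    exact Finset.sum_eq_zero fun c _ => by rw [map_mul, hk, mul_zero]

/-- Membership in `𝔞`. [folklore] -/
theorem mem_idealZ {k : P A r} : k ∈ idealZ ι ↔ ∀ (b : ℤ) (j : Fin (r + 1)), evalRing ι {j} (fracB A j b k) = 0 :=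
  Iff.rfl

/-- `𝔞` is homogeneous: it contains the homogeneous components of its elements. [folklore] -/
theorem hcomp_mem_idealZ {k : P A r} (hk : k ∈ idealZ ι) (dd : ℤ) : hcomp dd k ∈ idealZ ι := by
  intro b j
  rw [fracB_hcomp]
  split_ifs with h
  · exact hk dd j
  · rw [map_zero]

/-- The graded `P`-submodule of `P^{pt}` attached to `𝔞` (the rank-one free module `P` in the form
consumed by `LaurentCech.cech`). [folklore] -/
def KZ : Submodule (P A r) (Unit → P A r) := Submodule.pi Set.univ fun _ => idealZ ι

/-- Membership in `KZ`. [folklore] -/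
theorem mem_KZ {v : Unit → P A r} : v ∈ KZ ι ↔ v () ∈ idealZ ι := by
  simp only [KZ, Submodule.mem_pi, Set.mem_univ, forall_const]
  exact ⟨fun h => h (), fun h u => by cases u; exact h⟩

/-- `KZ` is graded (for the zero shift). [folklore] -/
theorem isGraded_KZ : IsGraded (0 : Unit → ℤ) (KZ ι) := by
  intro dd v hv
  rw [mem_KZ] at hv ⊢
  rw [projDeg_apply, Pi.zero_apply, sub_zero]
  exact hcomp_mem_idealZ ι hv dd

/-- Membership in the degree-`0` localized pieces of `KZ`: scalar form. [folklore] -/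
theorem mem_locDeg_KZ_iff {s : Finset (Fin (r + 1))} {v : Unit → L A r} :
    v ∈ locDeg (0 : Unit → ℤ) (KZ ι) s 0 ↔
      v () ∈ Ldeg A r 0 ∧ ∃ (N : ℕ) (k : P A r), k ∈ idealZ ι ∧ xs A s N * v () = toL A r k := by
  rw [mem_locDeg, mem_loc, mem_Kdeg]
  constructor
  · rintro ⟨⟨N, k, hk, hv⟩, hdeg⟩
    refine ⟨by simpa using hdeg (), N, k (), (mem_KZ ι).mp hk, ?_⟩
    have := congr_fun hv ()
    simpa using this
  · rintro ⟨h0, N, k, hk, hv⟩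
    refine ⟨⟨N, fun _ => k, (mem_KZ ι).mpr hk, funext fun _ => by simpa using hv⟩, fun _ => by simpa using h0⟩

/-- Membership in the degree-`0` localized pieces of the free module: scalar form. [folklore] -/
theorem mem_locDeg_top_unit_iff {s : Finset (Fin (r + 1))} {v : Unit → L A r} :
    v ∈ locDeg (0 : Unit → ℤ) (⊤ : Submodule (P A r) (Unit → P A r)) s 0 ↔ v () ∈ Bsub A r s := by
  haveI : Nonempty Unit := ⟨()⟩
  rw [mem_Bsub_iff_const_mem_locDeg (J := Unit)]

/-! ### `𝔞` localizes to the kernels of the evaluation maps: `(𝔞_{X_s})₀ = ker (B_s → Γ(Z, Z_s))` -/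

/-- Restriction kills nothing new: `evalRing` of an element coming from `B_{{j}}`, `j ∈ s`, is the
restriction of its `evalRing {j}`. [folklore] -/
theorem evalRing_of_mem_single {s : Finset (Fin (r + 1))} {j : Fin (r + 1)} (hj : j ∈ s) (x : Bsub A r {j}) :
    evalRing ι s ⟨x, Bsub_mono (Finset.singleton_subset_iff.mpr hj) x.2⟩ =
      Sections.res (strZ ι) (Zop_mono ι (Finset.singleton_subset_iff.mpr hj)) (evalRing ι {j} x) :=
  evalRing_res ι (Finset.singleton_subset_iff.mpr hj) x

/-- **`(𝔞_{X_s})₀ ⊆ ker`**: a degree-`0` element `x` with `x_s^N x ∈ 𝔞` vanishes on `Z_s` (`s` non-empty).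
Writing `x = (k / x_j^{D}) · (x_j^{D} / x_s^{N})` with `j ∈ s`, `D = N #s`, the first factor vanishes
on `Z_j ⊇ Z_s`. [folklore] -/
theorem evalRing_eq_zero_of_mem_idealZ {s : Finset (Fin (r + 1))} (hs : s.Nonempty) {x : Bsub A r s}
    {N : ℕ} {k : P A r} (hk : k ∈ idealZ ι) (hx : xs A s N * (x : L A r) = toL A r k) :
    evalRing ι s x = 0 := by
  obtain ⟨j, hj⟩ := hs
  set D : ℤ := N * s.card with hD
  -- `k` is homogeneous of degree `D`
  have hkdeg : toL A r k ∈ Ldeg A r D := by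
    rw [← hx]
    have := mul_mem_Ldeg (xs_mem_Ldeg (A := A) s N) x.2.1
    rwa [add_zero] at this
  have hkD : hcomp D k = k := hcomp_eq_self_of_toL_mem hkdeg
  -- the factor `w = x_j^D / x_s^N ∈ B_s`
  have hw : xs A {j} D * xs A s (-N) ∈ Bsub A r s := by
    rw [xs, xs, AddMonoidAlgebra.single_mul_single, mul_one]
    refine single_one_mem_Bsub ?_ fun i hi => ?_
    · rw [map_add, edeg_sx, edeg_sx, Finset.card_singleton, hD]; push_cast; ring
    · have hij : i ≠ j := fun h => hi (h ▸ hj)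
      simp [sx_apply, hi, hij]
  have hxeq : x = (⟨fracL A j D k, Bsub_mono (Finset.singleton_subset_iff.mpr hj) (fracL_mem j D k)⟩ : Bsub A r s) *
      ⟨_, hw⟩ := by
    apply Subtype.ext
    change (x : L A r) = fracL A j D k * (xs A {j} D * xs A s (-N))
    rw [fracL, hkD, ← hx]
    calc (x : L A r) = (xs A s N * xs A s (-N)) * ((xs A {j} (-D) * xs A {j} D) * x) := by
          rw [xs_mul_xs_neg, xs_neg_mul_xs, one_mul, one_mul]
      _ = _ := by ring
  rw [hxeq, map_mul]
  have h0 : evalRing ι s ⟨fracL A j D k, Bsub_mono (Finset.singleton_subset_iff.mpr hj) (fracL_mem j D k)⟩ = 0 := by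
    have := evalRing_of_mem_single ι hj (fracB A j D k)
    rw [hk D j, map_zero] at this
    exact this
  rw [h0, zero_mul]

/-! ### The geometric input: `Z_{s + j}` is a basic open of `Z_j`, so its sections localize -/

/-- The restriction to the chart through `appLE` is `resChart`. [folklore] -/
theorem appLE_chart_eq_resChart (s : Finset (Fin (r + 1))) (hs : s.Nonempty) :
    (chart s hs).appLE (Dplus A r s) ⊤ (chart_preimage_Dplus s hs).ge = resChart s hs := by
  have htop : ⊤ ≤ (Dplus A r s).ι ⁻¹ᵁ Dplus A r s := by rw [Scheme.Opens.ι_preimage_self]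
  have h2 : (Dplus A r s).ι.appLE (Dplus A r s) ⊤ htop = (Dplus A r s).topIso.inv := by
    rw [Scheme.Opens.ι_appLE, Scheme.Opens.topIso_inv]
    exact congrArg (fun q ↦ (PP A r).presheaf.map (Quiver.Hom.op q)) (Subsingleton.elim _ _)
  have h := Scheme.Hom.appLE_comp_appLE (isoD s hs).inv (Dplus A r s).ι (Dplus A r s) ⊤ ⊤ htop le_top
  rw [h2] at h
  rw [resChart, Scheme.Hom.appTop, Scheme.Hom.app_eq_appLE]
  exact h.symm

/-- The transition element `t_{s,j}` as an element of `B_{{j}}`. [folklore] -/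
def tElB (A : Type u) [CommRing A] (s : Finset (Fin (r + 1))) (j : Fin (r + 1)) : Bsub A r {j} :=
  ⟨tEl A s j, tEl_mem s j⟩

/-- `t_{s,j}` is the Laurent image of Mathlib's `Away.isLocalizationElem` for `f = X_{{j}}`,
`g = X_{s ∖ j}`. [folklore] -/
theorem awayToL_isLocalizationElem (s : Finset (Fin (r + 1))) (j : Fin (r + 1)) :
    awayToL A r {j} (HomogeneousLocalization.Away.isLocalizationElem (Xs_mem (A := A) {j})
      (Xs_mem (s.erase j))) = tEl A s j := by
  rw [HomogeneousLocalization.Away.isLocalizationElem, awayToL_mk, map_pow, Finset.card_singleton, pow_one]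
  rfl

/-- `awayEquiv.symm (t_{s,j})` is Mathlib's `isLocalizationElem`. [folklore] -/
theorem awayEquiv_symm_tElB (s : Finset (Fin (r + 1))) (j : Fin (r + 1)) :
    (awayEquiv A r {j}).symm (tElB A s j) =
      HomogeneousLocalization.Away.isLocalizationElem (Xs_mem (A := A) {j}) (Xs_mem (s.erase j)) := by
  apply awayToL_injective {j}
  rw [awayToL_awayEquiv_symm, awayToL_isLocalizationElem]
  rfl

/-- `X_{s + j} = X_{{j}} · X_{s ∖ j}`. [folklore] -/
theorem Xs_insert (s : Finset (Fin (r + 1))) (j : Fin (r + 1)) :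
    Xs A (insert j s) = Xs A {j} * Xs A (s.erase j) := by
  rw [Xs_singleton, X_mul_Xs_erase]

/-- **`D₊(X_{s+j})` is the basic open in `𝐏` of the section `awayToSection (t_{s,j})` over `D₊(x_j)`**
(`s ∖ j` non-empty; Mathlib `Proj.awayι_preimage_basicOpen` read back in `𝐏`). [folklore] -/
theorem Dplus_insert_eq_basicOpen {s : Finset (Fin (r + 1))} {j : Fin (r + 1)} (hsj : (s.erase j).Nonempty) :
    Dplus A r (insert j s) = (PP A r).basicOpen (Proj.awayToSection (grading A r) (Xs A {j})
      (HomogeneousLocalization.Away.isLocalizationElem (Xs_mem (A := A) {j}) (Xs_mem (s.erase j)))) := by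
  have hj : ({j} : Finset (Fin (r + 1))).Nonempty := Finset.singleton_nonempty j
  set t := HomogeneousLocalization.Away.isLocalizationElem (Xs_mem (A := A) {j}) (Xs_mem (s.erase j)) with ht
  set z := Proj.awayToSection (grading A r) (Xs A {j}) t with hz
  -- both opens lie in the range `D₊(x_j)` of the chart, so compare preimages
  have hle₁ : Dplus A r (insert j s) ≤ (chart (A := A) {j} hj).opensRange := by
    rw [opensRange_chart]; exact Dplus_mono (Finset.singleton_subset_iff.mpr (Finset.mem_insert_self j s))
  have hle₂ : (PP A r).basicOpen z ≤ (chart (A := A) {j} hj).opensRange := by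
    rw [opensRange_chart]; exact (PP A r).basicOpen_le _
  -- left: `⊤ ∩ D(t)`
  have h1 : chart {j} hj ⁻¹ᵁ Dplus A r (insert j s) = PrimeSpectrum.basicOpen t := by
    have hmul : Dplus A r (insert j s) = Dplus A r {j} ⊓ Proj.basicOpen (grading A r) (Xs A (s.erase j)) := by
      rw [Dplus, Xs_insert, Proj.basicOpen_mul]
    rw [hmul, Scheme.Hom.preimage_inf, chart_preimage_Dplus, top_inf_eq, chart,
      Proj.awayι_preimage_basicOpen (grading A r) (f_deg := Xs_mem {j}) (g_deg := Xs_mem (s.erase j))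
        (hm' := Finset.card_pos.mpr hsj)]
  -- right: `D(c^* z) = D(ΓSpecIso⁻¹ t) = D(t)`
  have h2' : (Spec (CommRingCat.of (HomogeneousLocalization.Away (grading A r) (Xs A {j})))).presheaf.map
      (homOfLE (chart_preimage_Dplus (A := A) {j} hj).ge).op ((chart {j} hj).app (Dplus A r {j}) z) =
        (Scheme.ΓSpecIso (.of (HomogeneousLocalization.Away (grading A r) (Xs A {j})))).inv t := by
    change (chart {j} hj).appLE (Dplus A r {j}) ⊤ (chart_preimage_Dplus (A := A) {j} hj).ge z = _
    rw [appLE_chart_eq_resChart, hz, resChart_awayToSection]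
  have h2 : chart {j} hj ⁻¹ᵁ (PP A r).basicOpen z = PrimeSpectrum.basicOpen t := by
    rw [Scheme.preimage_basicOpen]
    have := (Spec (CommRingCat.of (HomogeneousLocalization.Away (grading A r) (Xs A {j})))).basicOpen_res
      ((chart {j} hj).app (Dplus A r {j}) z) (homOfLE (chart_preimage_Dplus (A := A) {j} hj).ge).op
    rw [top_inf_eq, h2', basicOpen_eq_of_affine] at this
    exact this.symm
  calc Dplus A r (insert j s) = chart {j} hj ''ᵁ chart {j} hj ⁻¹ᵁ Dplus A r (insert j s) := by
        rw [Scheme.Hom.image_preimage_eq_opensRange_inf, inf_eq_right.mpr hle₁]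
    _ = chart {j} hj ''ᵁ chart {j} hj ⁻¹ᵁ (PP A r).basicOpen z := by rw [h1, h2]
    _ = _ := by rw [Scheme.Hom.image_preimage_eq_opensRange_inf, inf_eq_right.mpr hle₂]

/-- **`Z_{s+j}` is the basic open of `ū = t_{s,j}|_Z` in `Z_j`** (`s ∖ j` non-empty). [folklore] -/
theorem Zop_insert_eq_basicOpen {s : Finset (Fin (r + 1))} {j : Fin (r + 1)} (hsj : (s.erase j).Nonempty) :
    Zop ι (insert j s) = Z.basicOpen (show Γ(Z, Zop ι {j}) from evalRing ι {j} (tElB A s j)) := by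
  rw [evalRing_apply, awayEquiv_symm_tElB, ← Scheme.preimage_basicOpen, ← Dplus_insert_eq_basicOpen hsj]

/-- Restriction along an equality of opens reflects zero. [folklore] -/
theorem map_eq_zero_of_eq {X : Scheme.{u}} {W W' V : X.Opens} (e : W = W') (h : W ≤ V) (h' : W' ≤ V)
    (y : Γ(X, V)) (hy : X.presheaf.map (homOfLE h).op y = 0) : X.presheaf.map (homOfLE h').op y = 0 := by
  subst e; exact hy

/-- **Sections of `Z_j` vanishing on `Z_{s+j}` are killed by a power of `ū = t_{s,j}|_Z`**
(`Γ(Z, Z_{s+j}) = Γ(Z, Z_j)[1/ū]`, Mathlib `IsAffineOpen.isLocalization_basicOpen`; `Z_j` is affine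
because `ι` is affine). [folklore] -/
theorem exists_pow_mul_eq_zero [IsAffineHom ι] (s : Finset (Fin (r + 1))) (j : Fin (r + 1))
    (y : Sections (strZ ι) (Zop ι {j}))
    (hy : Sections.res (strZ ι) (Zop_mono ι (Finset.singleton_subset_iff.mpr (Finset.mem_insert_self j s))) y = 0) :
    ∃ m : ℕ, evalRing ι {j} (tElB A s j) ^ m * y = 0 := by
  rcases (s.erase j).eq_empty_or_nonempty with hsj | hsj
  · -- `s ⊆ {j}`: the restriction is along an equality of opens
    refine ⟨0, ?_⟩
    rw [pow_zero, one_mul]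
    have hins : insert j s = {j} := by
      ext i
      simp only [Finset.mem_insert, Finset.mem_singleton]
      constructor
      · rintro (h | h)
        · exact h
        · by_contra hij
          have : i ∈ s.erase j := Finset.mem_erase.mpr ⟨hij, h⟩
          rw [hsj] at this
          exact absurd this (Finset.notMem_empty i)
      · exact fun h => Or.inl h
    have heq : Zop ι (insert j s) = Zop ι {j} := by rw [hins]
    have := map_eq_zero_of_eq heq _ le_rfl y hy
    rwa [show homOfLE (le_rfl : Zop ι {j} ≤ Zop ι {j}) = 𝟙 _ from Subsingleton.elim _ _, op_id,
      Z.presheaf.map_id] at this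
  · have hU : IsAffineOpen (Zop ι {j}) :=
      (Proj.isAffineOpen_basicOpen _ _ (Xs_mem {j}) (by rw [Finset.card_singleton]; exact one_pos)).preimage ι
    set f : Γ(Z, Zop ι {j}) := evalRing ι {j} (tElB A s j) with hf
    haveI := hU.isLocalization_basicOpen f
    have heq : Zop ι (insert j s) = Z.basicOpen f := Zop_insert_eq_basicOpen ι hsj
    have h0 : algebraMap Γ(Z, Zop ι {j}) Γ(Z, Z.basicOpen f) y = 0 :=
      map_eq_zero_of_eq heq _ (Z.basicOpen_le f) y hy
    obtain ⟨⟨_, m, rfl⟩, hm⟩ := (IsLocalization.map_eq_zero_iff (Submonoid.powers f) Γ(Z, Z.basicOpen f) y).mp h0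
    exact ⟨m, hm⟩

/-! ### `ker (B_s → Γ(Z, Z_s)) ⊆ (𝔞_{X_s})₀` -/

/-- If `evalRing {j}` kills `x t_{s,j}^K` then it kills `x t_{s,j}^k` for all `k ≥ K`. [folklore] -/
theorem evalRing_mul_tEl_pow_eq_zero_of_le {s : Finset (Fin (r + 1))} {j : Fin (r + 1)} {x : L A r} {K k : ℕ}
    (hK : ∀ k, K ≤ k → x * tEl A s j ^ k ∈ Bsub A r {j}) (h0 : evalRing ι {j} ⟨x * tEl A s j ^ K, hK K le_rfl⟩ = 0)
    (hk : K ≤ k) : evalRing ι {j} ⟨x * tEl A s j ^ k, hK k hk⟩ = 0 := by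
  obtain ⟨d, rfl⟩ := Nat.exists_eq_add_of_le hk
  have : (⟨x * tEl A s j ^ (K + d), hK (K + d) hk⟩ : Bsub A r {j}) = ⟨x * tEl A s j ^ K, hK K le_rfl⟩ * tElB A s j ^ d := by
    apply Subtype.ext
    change x * tEl A s j ^ (K + d) = x * tEl A s j ^ K * tEl A s j ^ d
    rw [pow_add, mul_assoc]
  rw [this, map_mul, h0, zero_mul]

/-- **For `x ∈ ker (B_s → Γ(Z, Z_s))` and any `j`, `x t_{s,j}^k ∈ ker (B_{{j}} → Γ(Z, Z_j))` for all
large `k`**: `x t^{k₀}` lies in `B_{{j}}` (clearing denominators), its value on `Z_j`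
restricts to `0` on `Z_{s+j} = D(ū)`, hence is killed by a power of `ū = t|_Z`. [folklore] -/
theorem exists_forall_evalRing_mul_tEl_pow_eq_zero [IsAffineHom ι] {s : Finset (Fin (r + 1))}
    {x : Bsub A r s} (hx : evalRing ι s x = 0) (j : Fin (r + 1)) :
    ∃ (K : ℕ) (hK : ∀ k, K ≤ k → (x : L A r) * tEl A s j ^ k ∈ Bsub A r {j}),
      ∀ k (hk : K ≤ k), evalRing ι {j} ⟨(x : L A r) * tEl A s j ^ k, hK k hk⟩ = 0 := by
  have hsub : s ⊆ insert j s := Finset.subset_insert j s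
  have hjsub : ({j} : Finset (Fin (r + 1))) ⊆ insert j s := Finset.singleton_subset_iff.mpr (Finset.mem_insert_self j s)
  -- clearing denominators
  obtain ⟨k₀, hk₀⟩ := exists_mul_tEl_pow_mem (A := A) (s := s) (j := j) (Bsub_mono hsub x.2)
  -- the value of `x t^{k₀}` on `Z_j` restricts to zero on `Z_{s+j}`
  have hres : Sections.res (strZ ι) (Zop_mono ι hjsub) (evalRing ι {j} ⟨(x : L A r) * tEl A s j ^ k₀, hk₀ k₀ le_rfl⟩) = 0 := by
    rw [← evalRing_res ι hjsub]
    have heq : (⟨((⟨(x : L A r) * tEl A s j ^ k₀, hk₀ k₀ le_rfl⟩ : Bsub A r {j}) : L A r), Bsub_mono hjsub (hk₀ k₀ le_rfl)⟩ :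
        Bsub A r (insert j s)) = ⟨x, Bsub_mono hsub x.2⟩ * ⟨tEl A s j, Bsub_mono hjsub (tEl_mem s j)⟩ ^ k₀ :=
      Subtype.ext rfl
    rw [heq, map_mul, map_pow, evalRing_res ι hsub x, hx, map_zero, zero_mul]
  obtain ⟨m, hm⟩ := exists_pow_mul_eq_zero ι s j _ hres
  refine ⟨k₀ + m, fun k hk => hk₀ k (by omega), fun k hk => ?_⟩
  apply evalRing_mul_tEl_pow_eq_zero_of_le ι (fun k hk => hk₀ k (by omega)) ?_ hk
  have heq : (⟨(x : L A r) * tEl A s j ^ (k₀ + m), hk₀ (k₀ + m) (by omega)⟩ : Bsub A r {j}) =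
      tElB A s j ^ m * ⟨(x : L A r) * tEl A s j ^ k₀, hk₀ k₀ le_rfl⟩ := by
    apply Subtype.ext
    change (x : L A r) * tEl A s j ^ (k₀ + m) = tEl A s j ^ m * ((x : L A r) * tEl A s j ^ k₀)
    rw [pow_add]; ring
  rw [heq, map_mul, map_pow]
  exact hm

/-- **`ker (B_s → Γ(Z, Z_s)) ⊆ (𝔞_{X_s})₀`**: a degree-`0` fraction `x = p / X_s^{N₀}` vanishing on `Z_s`
satisfies `x_s^N x ∈ 𝔞` for `N` large: `p X_s^M ∈ 𝔞` with `M` larger than all the exponents of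
`exists_forall_evalRing_mul_tEl_pow_eq_zero`, because `(p X_s^M) / x_j^{deg} = x t_{s,j}^{N₀ + M}`.
[folklore] -/
theorem exists_mem_idealZ_of_evalRing_eq_zero [IsAffineHom ι] {s : Finset (Fin (r + 1))}
    {x : Bsub A r s} (hx : evalRing ι s x = 0) :
    ∃ (N : ℕ) (k : P A r), k ∈ idealZ ι ∧ xs A s N * (x : L A r) = toL A r k := by
  obtain ⟨N₀, p, hp⟩ := x.2.2
  choose K hK hK0 using exists_forall_evalRing_mul_tEl_pow_eq_zero ι hx
  set M := Finset.univ.sup K with hM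
  have hKM : ∀ j, K j ≤ N₀ + M := fun j => (Finset.le_sup (f := K) (Finset.mem_univ j)).trans (Nat.le_add_left _ _)
  refine ⟨N₀ + M, p * Xs A s ^ M, ?_, ?_⟩
  · -- `p X_s^M ∈ 𝔞`
    set k' := p * Xs A s ^ M with hk'
    have htoL : toL A r k' = xs A s (N₀ + M) * x := by
      rw [hk', map_mul, toL_Xs_pow, ← hp, xs_add]; ring
    have hdeg : toL A r k' ∈ Ldeg A r ((N₀ + M : ℕ) * s.card : ℤ) := by
      rw [htoL]
      have := mul_mem_Ldeg (xs_mem_Ldeg (A := A) s (N₀ + M : ℕ)) x.2.1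
      rwa [add_zero] at this
    intro b j
    by_cases hb : b = ((N₀ + M : ℕ) * s.card : ℤ)
    · -- the relevant degree: the fraction is `x t_{s,j}^{N₀ + M}`
      have hval : (fracB A j b k' : L A r) = (x : L A r) * tEl A s j ^ (N₀ + M) := by
        rw [coe_fracB, fracL, hb, hcomp_eq_self_of_toL_mem hdeg, htoL, ← xs_mul_xs_single_eq_tEl_pow s j (N₀ + M)]
        push_cast; ring
      have : fracB A j b k' = ⟨(x : L A r) * tEl A s j ^ (N₀ + M), hK j _ (hKM j)⟩ := Subtype.ext hval
      rw [this]
      exact hK0 j _ (hKM j)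
    · -- other degrees: the component vanishes
      have h0 : hcomp b k' = 0 := by
        rw [← hcomp_eq_self_of_toL_mem hdeg, hcomp_hcomp, if_neg hb]
      have : fracB A j b k' = 0 := by
        apply Subtype.ext
        rw [coe_fracB, fracL, h0, map_zero, zero_mul]
        rfl
      rw [this, map_zero]
  · rw [map_mul, toL_Xs_pow, ← hp, Nat.cast_add, xs_add]; ring

/-! ### The Čech complex of `𝒪_Z` on the cover `Z_i = Z ∩ D₊(x_i)` and the short exact sequence -/

open OrderedCech

/-- The degree-`0` Čech family of the free module of rank one: `s ↦ B_s` (as submodules of `L^{pt}`).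
[folklore] -/
abbrev famP (A : Type u) [CommRing A] (r : ℕ) (s : Finset (Fin (r + 1))) : Submodule A (Unit → L A r) :=
  locDeg (0 : Unit → ℤ) (⊤ : Submodule (P A r) (Unit → P A r)) s 0

/-- The degree-`0` Čech family of the ideal `𝔞`: `s ↦ (𝔞_{X_s})₀`. [folklore] -/
abbrev famI (s : Finset (Fin (r + 1))) : Submodule A (Unit → L A r) :=
  locDeg (0 : Unit → ℤ) (KZ ι) s 0

/-- The `p`-cochains of `𝒪_Z` on the cover `(Z_i)`: a section of `𝒪_Z` over `Z_σ` for each `p`-simplex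
`σ = {i₀ < ⋯ < i_p}` (the alternating Čech complex, Stacks Project, Tag 01FG). [folklore] -/
abbrev QX (p : ℤ) : Type u := ∀ σ : Simplex (Fin (r + 1)) p, Sections (strZ ι) (Zop ι σ.1)

/-- A face of a simplex with its restriction map, as a linear map `Q^p → Γ(Z, Z_σ)` (zero if the face is
not a simplex). [folklore] -/
def faceQ (p : ℤ) (σ : Simplex (Fin (r + 1)) (p + 1)) (a : Fin (r + 1)) :
    QX ι p →ₗ[A] Sections (strZ ι) (Zop ι σ.1) :=
  if h : (σ.1.erase a).Nonempty ∧ ((σ.1.erase a).card : ℤ) = p + 1 then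
    (Sections.res (strZ ι) (Zop_mono ι (Finset.erase_subset a σ.1))).toLinearMap ∘ₗ
      LinearMap.proj (R := A) (φ := fun τ : Simplex (Fin (r + 1)) p => Sections (strZ ι) (Zop ι τ.1))
        ⟨σ.1.erase a, h⟩
  else 0

/-- `faceQ` on a genuine face. [folklore] -/
theorem faceQ_apply_of {p : ℤ} (σ : Simplex (Fin (r + 1)) (p + 1)) (a : Fin (r + 1))
    (h : (σ.1.erase a).Nonempty ∧ ((σ.1.erase a).card : ℤ) = p + 1) (c : QX ι p) :
    faceQ ι p σ a c = Sections.res (strZ ι) (Zop_mono ι (Finset.erase_subset a σ.1)) (c ⟨σ.1.erase a, h⟩) := by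
  rw [faceQ, dif_pos h]; rfl

/-- `faceQ` vanishes when the face is not a simplex. [folklore] -/
theorem faceQ_apply_of_not {p : ℤ} (σ : Simplex (Fin (r + 1)) (p + 1)) (a : Fin (r + 1))
    (h : ¬((σ.1.erase a).Nonempty ∧ ((σ.1.erase a).card : ℤ) = p + 1)) (c : QX ι p) :
    faceQ ι p σ a c = 0 := by
  rw [faceQ, dif_neg h]; rfl

/-- **The Čech differential of `𝒪_Z`**: `(d c)_σ = Σ_{a ∈ σ} ε(σ, a) c_{σ ∖ a}|_{Z_σ}`. [folklore] -/
def dQ (p : ℤ) : QX ι p →ₗ[A] QX ι (p + 1) :=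
  LinearMap.pi fun σ => ∑ a ∈ σ.1, sign A σ.1 a • faceQ ι p σ a

/-- `dQ` unfolded. [folklore] -/
theorem dQ_apply {p : ℤ} (c : QX ι p) (σ : Simplex (Fin (r + 1)) (p + 1)) :
    dQ ι p c σ = ∑ a ∈ σ.1, sign A σ.1 a • faceQ ι p σ a c := by
  rw [dQ, LinearMap.pi_apply, LinearMap.sum_apply]
  rfl

/-- The membership of the values of cochains of `B_•` in the subalgebras `B_σ`. [folklore] -/
theorem apply_unit_mem_Bsub {p : ℤ} (c : Cochain (famP A r) p) (σ : Simplex (Fin (r + 1)) p) :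
    (c σ : Unit → L A r) () ∈ Bsub A r σ.1 :=
  mem_locDeg_top_unit_iff.mp (c σ).2

/-- **The comparison map `Č^p_0(P) → Q^p`**: evaluate the fraction of `B_σ` on `Z_σ`. [folklore] -/
def qMap (p : ℤ) : Cochain (famP A r) p →ₗ[A] QX ι p where
  toFun c σ := evalAlg ι σ.1 σ.2.1 ⟨(c σ : Unit → L A r) (), apply_unit_mem_Bsub c σ⟩
  map_add' c c' := by
    funext σ
    rw [Pi.add_apply, ← map_add]
    rfl
  map_smul' a c := by
    funext σ
    rw [Pi.smul_apply, RingHom.id_apply, ← map_smul]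
    rfl

/-- `qMap` unfolded. [folklore] -/
theorem qMap_apply {p : ℤ} (c : Cochain (famP A r) p) (σ : Simplex (Fin (r + 1)) p) :
    qMap ι p c σ = evalRing ι σ.1 ⟨(c σ : Unit → L A r) (), apply_unit_mem_Bsub c σ⟩ := rfl

/-- The extension by zero of a cochain has its value in `B_s`. [folklore] -/
theorem ext0_unit_mem_Bsub {p : ℤ} (c : Cochain (famP A r) p) (s : Finset (Fin (r + 1))) :
    (c.ext0 s) () ∈ Bsub A r s :=
  mem_locDeg_top_unit_iff.mp (ext0_mem c s)

/-- **`qMap` is a morphism of complexes**: `q (d c) = d (q c)`. [folklore] -/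
theorem qMap_d {p : ℤ} (c : Cochain (famP A r) p) :
    qMap ι (p + 1) (OrderedCech.d (famP A r) (locDeg_mono _ _ 0) p c) = dQ ι p (qMap ι p c) := by
  funext σ
  rw [dQ_apply]
  change evalAlg ι σ.1 σ.2.1 _ = _
  -- the value of `d c` at `σ`, as an element of `B_σ`
  have hval : (⟨((OrderedCech.d (famP A r) (locDeg_mono _ _ 0) p c σ : Unit → L A r) ()),
      apply_unit_mem_Bsub _ σ⟩ : Bsub A r σ.1) =
        ∑ a ∈ σ.1, sign A σ.1 a • ⟨(c.ext0 (σ.1.erase a)) (),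
          Bsub_mono (Finset.erase_subset a σ.1) (ext0_unit_mem_Bsub c _)⟩ := by
    apply Subtype.ext
    have h1 := congr_fun (coe_d_apply (famP A r) (locDeg_mono _ _ 0) p c σ) ()
    rw [Finset.sum_apply] at h1
    refine h1.trans ?_
    rw [← Subalgebra.val_apply, map_sum]
    refine Finset.sum_congr rfl fun a _ => ?_
    rw [map_smul, Subalgebra.val_apply, Pi.smul_apply]
  rw [hval, map_sum]
  refine Finset.sum_congr rfl fun a _ => ?_
  rw [map_smul]
  congr 1
  rw [evalAlg_apply]
  by_cases h : (σ.1.erase a).Nonempty ∧ ((σ.1.erase a).card : ℤ) = p + 1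
  · rw [faceQ_apply_of ι σ a h, qMap_apply, ← evalRing_res ι (Finset.erase_subset a σ.1)]
    congr 1
    apply Subtype.ext
    exact congr_fun (Cochain.ext0_val c ⟨σ.1.erase a, h⟩) ()
  · rw [faceQ_apply_of_not ι σ a h]
    have : (⟨(c.ext0 (σ.1.erase a)) (), Bsub_mono (Finset.erase_subset a σ.1) (ext0_unit_mem_Bsub c _)⟩ :
        Bsub A r σ.1) = 0 := by
      apply Subtype.ext
      change (c.ext0 (σ.1.erase a)) () = 0
      rw [Cochain.ext0, dif_neg h]
      rfl
    rw [this, map_zero]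

/-- The inclusion of families `(𝔞_{X_s})₀ ⊆ B_s`. [folklore] -/
theorem famI_le_famP : ∀ s, ∀ x ∈ famI ι s, LinearMap.id (R := A) x ∈ famP A r s :=
  fun s _ hx => ⟨loc_mono_left le_top s hx.1, hx.2⟩

variable [IsClosedImmersion ι]

/-- `qMap` is surjective in each degree (the evaluation maps are, `ι` being a closed immersion). [folklore] -/
theorem qMap_surjective (p : ℤ) : Function.Surjective (qMap ι p) := by
  intro y
  have h : ∀ σ : Simplex (Fin (r + 1)) p, ∃ x : Bsub A r σ.1, evalRing ι σ.1 x = y σ :=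
    fun σ => evalRing_surjective ι σ.1 σ.2.1 (y σ)
  choose x hx using h
  refine ⟨fun σ => ⟨fun _ => (x σ : L A r), mem_locDeg_top_unit_iff.mpr (x σ).2⟩, funext fun σ => ?_⟩
  rw [qMap_apply, ← hx σ]

/-- `dQ ∘ dQ = 0` (transported from `Č_0(P)` along the surjection `qMap`). [folklore] -/
theorem dQ_dQ (p : ℤ) (c : QX ι p) : dQ ι (p + 1) (dQ ι p c) = 0 := by
  obtain ⟨c, rfl⟩ := qMap_surjective ι p c
  rw [← qMap_d, ← qMap_d, OrderedCech.d_d, map_zero]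

/-- **The Čech complex `Č(𝒰, 𝒪_Z)` of the structure sheaf of the closed subscheme `Z ⊆ 𝐏^r_A` on the
cover `Z_i = Z ∩ D₊(x_i)`** (alternating version, Stacks Project, Tag 01FG), a cochain complex of
`A`-modules. [folklore] -/
def cechZ : CochainComplex (ModuleCat.{u} A) ℤ :=
  CochainComplex.of (fun p => ModuleCat.of A (QX ι p)) (fun p => ModuleCat.ofHom (dQ ι p)) fun p =>
    ModuleCat.hom_ext (LinearMap.ext fun c => dQ_dQ ι p c)

/-- The differentials of `cechZ`. [folklore] -/
theorem cechZ_d (p : ℤ) : (cechZ ι).d p (p + 1) = ModuleCat.ofHom (dQ ι p) := by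
  change CochainComplex.of.d (V := ModuleCat.{u} A) (fun p => ModuleCat.of A (QX ι p))
    (fun p => ModuleCat.ofHom (dQ ι p)) p (p + 1) = _
  exact CochainComplex.of_d _ _ p

/-- The comparison morphism of complexes `Č_0(P) → Č(𝒰, 𝒪_Z)`. [folklore] -/
def qHom : cech (0 : Unit → ℤ) (⊤ : Submodule (P A r) (Unit → P A r)) 0 ⟶ cechZ ι :=
  CochainComplex.ofHom (fun p => ModuleCat.ofHom (qMap ι p)) fun p => by
    change ModuleCat.ofHom (qMap ι p) ≫ (cechZ ι).d p (p + 1) =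
      (OrderedCech.complex (famP A r) (locDeg_mono _ _ 0)).d p (p + 1) ≫ ModuleCat.ofHom (qMap ι (p + 1))
    rw [cechZ_d, OrderedCech.complex_d]
    exact ModuleCat.hom_ext (LinearMap.ext fun c => (qMap_d ι c).symm)

/-- **The short exact sequence `0 → Č_0(𝔞) → Č_0(P) → Č(𝒰, 𝒪_Z) → 0`** of cochain complexes of
`A`-modules (inclusion, then `qHom`), as a short complex. [folklore] -/
def sesZ : ShortComplex (CochainComplex (ModuleCat.{u} A) ℤ) :=
  ShortComplex.mk
    (complexMap (F := famI ι) (G := famP A r) LinearMap.id (famI_le_famP ι) (locDeg_mono _ _ 0) (locDeg_mono _ _ 0))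
    (qHom ι) (by
      ext p (c : Cochain (famI ι) p)
      change qMap ι p (Cochain.map LinearMap.id (famI_le_famP ι) p c) = 0
      funext σ
      rw [qMap_apply, Pi.zero_apply]
      obtain ⟨-, N, k, hk, hkx⟩ := (mem_locDeg_KZ_iff ι).mp (c σ).2
      exact evalRing_eq_zero_of_mem_idealZ ι σ.2.1 hk hkx)

/-- **`0 → Č_0(𝔞) → Č_0(P) → Č(𝒰, 𝒪_Z) → 0` is short exact** (degreewise: the inclusion is injective,
`qMap` is surjective, and its kernel is `Č_0(𝔞)` by the identification `(𝔞_{X_s})₀ = ker (B_s → Γ(Z, Z_s))`).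
This is the algebraic form of the exactness of `0 → 𝓘_Z → 𝒪_𝐏 → ι_* 𝒪_Z → 0` on the affine opens
`D₊(X_σ)`. [folklore] -/
theorem shortExact_sesZ : (sesZ ι).ShortExact := by
  apply HomologicalComplex.shortExact_of_degreewise_shortExact
  intro p
  apply ModuleCat.shortComplex_shortExact
  · intro (c : Cochain (famP A r) p)
    constructor
    · intro (hc : qMap ι p c = 0)
      have hmem : ∀ σ : Simplex (Fin (r + 1)) p, (c σ : Unit → L A r) ∈ famI ι σ.1 := by
        intro σ
        have h0 : evalRing ι σ.1 ⟨(c σ : Unit → L A r) (), apply_unit_mem_Bsub c σ⟩ = 0 := by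
          rw [← qMap_apply, hc]; rfl
        obtain ⟨N, k, hk, hkx⟩ := exists_mem_idealZ_of_evalRing_eq_zero ι h0
        exact (mem_locDeg_KZ_iff ι).mpr ⟨(apply_unit_mem_Bsub c σ).1, N, k, hk, hkx⟩
      exact ⟨fun σ => ⟨(c σ : Unit → L A r), hmem σ⟩, funext fun σ => Subtype.ext rfl⟩
    · rintro ⟨c', rfl⟩
      change qMap ι p (Cochain.map LinearMap.id (famI_le_famP ι) p c') = 0
      funext σ
      rw [qMap_apply, Pi.zero_apply]
      obtain ⟨-, N, k, hk, hkx⟩ := (mem_locDeg_KZ_iff ι).mp (c' σ).2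
      exact evalRing_eq_zero_of_mem_idealZ ι σ.2.1 hk hkx
  · exact Cochain.map_injective LinearMap.id (famI_le_famP ι) fun _ _ _ h => h
  · exact qMap_surjective ι p

/-- **`H¹` of the Čech complex of `𝒪_Z` is a finitely generated `A`-module** for `A` Noetherian: Serre's
finiteness theorem (`LaurentCech.moduleFinite_homology_of_shortExact`, Hartshorne III Thm. 5.2 (a))
applied to `0 → Č_0(𝔞) → Č_0(P) → Č(𝒰, 𝒪_Z) → 0`. [folklore] -/
theorem moduleFinite_homology_cechZ [IsNoetherianRing A] (i : ℤ) (hi : 1 ≤ i) :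
    Module.Finite A ((cechZ ι).homology i) :=
  moduleFinite_homology_of_shortExact (0 : Unit → ℤ) (isGraded_KZ ι) 0 (sesZ ι) (shortExact_sesZ ι) rfl rfl i hi

end ProjCech

end Literature.AlgebraicGeometry.Morphisms
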